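import Summits.BirchSwinnertonDyer.BirchSwinnertonDyer.Theorems.Rank2Observatory2DescClFieldCertQ2RegW
import Summits.BirchSwinnertonDyer.BirchSwinnertonDyer.Theorems.Rank2Observatory2DescClEtaCert
import Summits.BirchSwinnertonDyer.BirchSwinnertonDyer.Theorems.Rank2Observatory2DescClClassGenGcd
import HarnessLib

/-!
# BirchSwinnertonDyer — rank ≥ 2 observatory: KERNEL-2DESC-CL E2Q2 — the TWO-VIEW per-field record with TWO auxiliary primes (`ClFieldCertEQ`), part 3/8

HONEST FRAMING: per-curve certified theorems and census instruments; no claim on BSD in rank ≥ 2.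

The two-view per-field record of v2.3 (`ClFieldCertE`: an `α`-view v2.0 record + a second generator `η = u(α)/d`
with monic minimal polynomial `h = X³ + a′X² + b′X + c′`, `etaCheck` of `…2DescClEtaCert`, and `η`-rows naming the
primes above the index primes of `α`) transplanted onto the TWO-AUXILIARY-PRIME record of Q2: `ClFieldCertEQ` =
`base : ClFieldCertQ2` (its registry core `checkReg` of part 1 is used, its one-view sweep is NOT) + `(u, d, a′, b′,
c′, pIrrE, primesE)` + two-view class-certificate data `c2 : ClsCert2Q`.  The class certificates are RELATIVE TO
BOTH auxiliary primes — `β ∈ P` with `|N β| = N(P)·q₁^j·q₂^k`, the pair packed as `j + 64·k` exactly as in Q2's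
`classCheck₂` — in each code's own view (`α`: one-view `classCheck₂` on `base`, or two-view `classCheck2 true`;
`η`: `classCheck₂` over `(a′, b′, c′)` or `classCheck2 false`), and the TWO-VIEW SWEEP `checkSweepE` covers every
prime `p < bM` by `q₁`, `q₂`, an `α`-row or an `η`-row, the Minkowski inequality being tested against
`gcd(Δ(g), Δ(h))` (tree lemma `eq_top_of_classIn_lt_gcd`).  Main consequence: `closure_q2_eq_top_of_coreE` —
**the classes of the ideals containing `q₁·q₂` generate `Cl(K)`** — for a field that need be neither monogenic nor
of cyclic class group.  `checkE = base.checkField ∧ checkCoreE` is the complex per-field checker run once per field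
by `decide +kernel`.  Population: the 590 certified non-monogenic complex cubic 2-division fields with non-cyclic
class group of the rank-2 census (1 091 curves; `census/coverage/nonmono_noncyclic_g29.tsv`), of which 517 fields /
909 curves carry an `η` of coprime index (`generics/q2m/census/etacensus_j223295.json`).
Sorry-free; new declarations only; axioms `propext`, `Classical.choice`, `Quot.sound`.
[cite: Cohen1993, §4.8.2, §6.2, §6.5] [cite: Marcus2018, Ch. 3, Thm. 27; Ch. 5, Thm. 35 and Cor. 2] [cite: Cassels1991LecturesEllipticCurves, §15]
-/

set_option linter.dupNamespace false

noncomputable section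

open scoped Classical NumberField nonZeroDivisors

open Literature.NumberTheory.NumberFields Polynomial Module NumberField IsDedekindDomain Ideal

namespace Summit.BirchSwinnertonDyer.BirchSwinnertonDyer.Rank2Observatory.TwoDescCl

open TwoDescCubic

variable {K : Type*} [Field K] [NumberField K] {θ : K}

/-! ## Two-prime relation certificate through a multiple -/

/-- **Two-prime relation certificate through a multiple.** In the view `θv` (root of `X³ + AX² + BX + C₀`): if
`m·β = Z(θv)` with `m` prime to `p`, `Z(θv) ∈ (p, G(θv))` by coefficients and `|N(Z)| = m³ · p^deg · q₁^j · q₂^k`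
(`jk = j + 64k`), then `β ∈ (p, G(θv))` with `|N(β)| = p^deg · q₁^j q₂^k`, so the class of `(p, G(θv))` lies in
`H_{q₁q₂}`. [cite: Marcus2018, Ch. 5, Thm. 35] [cite: Cohen1993, §6.5 (relations)] -/
theorem classIn_of_rel2Q {A B C₀ : ℤ} {θv : K} (hirr : Irreducible (MonicCubic.polyQ A B C₀))
    (hθv : aeval θv (MonicCubic.poly A B C₀) = 0) (h3 : finrank ℚ K = 3) {e : PrimeEntry} (hp : e.p.Prime)
    (h : e.check A B C₀ = true) {C : PCode} (hC : C ∈ e.codes) {q₁ q₂ : ℕ} (hq₁ : q₁.Prime) (hq₂ : q₂.Prime)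
    {m : ℕ} (hm : Nat.Coprime m C.1) {Z : ℤ × ℤ × ℤ} (hmem : memCode C Z = true) {β : 𝓞 K}
    (hβ : (m : 𝓞 K) * β = lin hθv Z.1 Z.2.1 Z.2.2) {jk : ℕ}
    (hN : (normFormZ A B C₀ Z.1 Z.2.1 Z.2.2).natAbs =
      m ^ 3 * (C.1 ^ codeDeg C * (q₁ ^ (jk % 64) * q₂ ^ (jk / 64)))) :
    ClassIn (tsuppClosure (((q₁ * q₂ : ℕ) : ℕ) : 𝓞 K)) (idealOf hθv C) := by
  have hP := isPrime_and_ne_bot_of_check hirr hθv h3 hp h hC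
  have habs := absNorm_of_check hirr hθv h3 hp h hC
  have hfst := code_fst_of_mem hC
  have hlin : lin hθv Z.1 Z.2.1 Z.2.2 ∈ idealOf hθv C := lin_mem_idealOf_of_memCode hθv C _ hmem
  have hpmem : ((C.1 : ℕ) : 𝓞 K) ∈ idealOf hθv C := by
    unfold idealOf; exact Ideal.subset_span (Set.mem_insert _ _)
  let w : HeightOneSpectrum (𝓞 K) := ⟨idealOf hθv C, hP.1, hP.2⟩
  have hmw : (m : 𝓞 K) ∉ w.asIdeal := natCast_not_mem_of_coprime w hpmem hm
  have hβmem : β ∈ idealOf hθv C := (mem_iff_of_natCast_mul_eq w hmw hβ).mpr hlin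
  have hm0 : 0 < m := by
    rcases Nat.eq_zero_or_pos m with rfl | h0
    · rw [Nat.coprime_zero_left, hfst] at hm; exact absurd hm hp.one_lt.ne'
    · exact h0
  have h1 : (Algebra.norm ℤ ((m : 𝓞 K) * β)).natAbs =
      m ^ 3 * (C.1 ^ codeDeg C * (q₁ ^ (jk % 64) * q₂ ^ (jk / 64))) := by
    rw [hβ, natAbs_norm_lin_coords hirr hθv h3 Z]; exact hN
  have hnm : Algebra.norm ℤ (m : 𝓞 K) = (m : ℤ) ^ 3 := by
    rw [show (m : 𝓞 K) = algebraMap ℤ (𝓞 K) (m : ℤ) by simp, Algebra.norm_algebraMap,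
      NumberField.RingOfIntegers.rank, h3]
  rw [map_mul, hnm, Int.natAbs_mul, Int.natAbs_pow, Int.natAbs_natCast] at h1
  have h2 : (Algebra.norm ℤ β).natAbs = absNorm (idealOf hθv C) * (q₁ ^ (jk % 64) * q₂ ^ (jk / 64)) := by
    rw [habs, ← hfst]
    exact Nat.eq_of_mul_eq_mul_left (pow_pos hm0 3) h1
  exact ClassIn.of_mem_of_absNorm hP.2 hβmem (Nat.mul_pos (pow_pos hq₁.pos _) (pow_pos hq₂.pos _)) h2
    fun Q hQ hQ0 hdvd => classIn_tsupp₂_of_absNorm_dvd hq₁ hq₂ Q hQ hQ0 hdvd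

/-! ## The two-view two-prime record -/

/-- **Two-view class-certificate data** (two auxiliary primes): multipliers `m₁, m₂` with a Bezout pair
`s·m₁ + t·m₂ = 1` and the certificates `((tag, code), X, Y, j + 64·k)` — the element `x = s·X(α) + t·Y(η) ∈ 𝓞 K`
(`m₁x = X(α)`, `m₂x = Y(η)`) lies in the code's prime and `|N(x)| = p^deg · q₁^j · q₂^k`, read in the code's own
view (`tag = true`: `α`, on `X`; `false`: `η`, on `Y`).  Pure data. -/
structure ClsCert2Q where
  /-- the `α`-multiplier -/
  m₁ : ℕ
  /-- the `η`-multiplier -/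
  m₂ : ℕ
  /-- Bezout: `s m₁ + t m₂ = 1` -/
  s : ℤ
  /-- Bezout: `s m₁ + t m₂ = 1` -/
  t : ℤ
  /-- the certificates `((tag, code), X, Y, j + 64·k)` -/
  certs : List ((Bool × PCode) × (ℤ × ℤ × ℤ) × (ℤ × ℤ × ℤ) × ℕ)

/-- **Two-view per-field certificate with two auxiliary primes**: a Q2 record `base` for the `α`-view (its
`primes` are rows of non-index primes only, with class certificates `(x, y, z, j + 64k)` relative to `q₁, q₂`;
its one-view sweep clause is NOT used) plus the second generator `η = u(α)/d`, its minimal polynomial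
`h = X³ + a′X² + b′X + c′`, an irreducibility modulus for `h`, the `η`-rows `primesE` (rows over `(a′, b′, c′)`,
typically of the index primes of `α`; never `q₁`, `q₂`) and two-view class certificates. Pure data.
[cite: Cohen1993, §6.2, §6.5] -/
structure ClFieldCertEQ where
  /-- the `α`-view two-prime record (Q2) -/
  base : ClFieldCertQ2
  /-- `η = (u₀ + u₁α + u₂α²)/d` -/
  u : ℤ × ℤ × ℤ
  /-- `η = (u₀ + u₁α + u₂α²)/d`, `0 < d` -/
  d : ℕ
  /-- `h = X³ + a′X² + b′X + c′`, the minimal polynomial of `η` -/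
  a' : ℤ
  /-- `h = X³ + a′X² + b′X + c′` -/
  b' : ℤ
  /-- `h = X³ + a′X² + b′X + c′` -/
  c' : ℤ
  /-- a modulus modulo which `h` has no root (irreducibility of `h`) -/
  pIrrE : ℕ
  /-- registry rows in the `η`-view (never `q₁`, `q₂`) -/
  primesE : List PrimeEntry
  /-- two-view class certificates for the sweep (may be empty) -/
  c2 : ClsCert2Q

namespace ClFieldCertEQ

variable (fe : ClFieldCertEQ)

/-- All primes whose primality the row files discharge: those of `base`, then the `η`-row primes. -/
def primeListE : List ℕ := fe.base.primeList ++ fe.primesE.map PrimeEntry.p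

/-- `η`-registry clause: every `η`-row is checked over `(a′, b′, c′)` and its prime is neither `q₁` nor `q₂`.
Computable. -/
def checkRegistryE : Bool :=
  fe.primesE.all fun e => e.check fe.a' fe.b' fe.c' && e.p != fe.base.q₁ && e.p != fe.base.q₂

/-- The view-local part of a two-view two-prime class certificate: `m` prime to `p`, `Z ∈ (p, G)` by coefficients,
`|N(Z)| = m³ · p^deg · q₁^j · q₂^k` (`jk = j + 64k`). Computable. -/
def classRelQ (A B C₀ : ℤ) (m q₁ q₂ : ℕ) (C : PCode) (Z : ℤ × ℤ × ℤ) (jk : ℕ) : Bool :=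
  decide (Nat.Coprime m C.1) && memCode C Z &&
    decide ((normFormZ A B C₀ Z.1 Z.2.1 Z.2.2).natAbs = m ^ 3 * (C.1 ^ codeDeg C * (q₁ ^ (jk % 64) * q₂ ^ (jk / 64))))

/-- **Two-view two-prime class certificate** of the code `C` of a row in view `tag` (`true` = `α`): the certificate
is for this code and view, the Bezout pair and the two-view consistency hold, and the view-local relation holds on
the view's coordinates. Computable. [cite: Cohen1993, §6.5 (relations)] -/
def classCheck2 (tag : Bool) (C : PCode) (ce : (Bool × PCode) × (ℤ × ℤ × ℤ) × (ℤ × ℤ × ℤ) × ℕ) : Bool :=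
  (ce.1.1 == tag) && (ce.1.2 == C) && bezoutCheck fe.c2.s fe.c2.t fe.c2.m₁ fe.c2.m₂ &&
    twoViewCheck fe.base.a fe.base.b fe.base.c fe.u fe.d fe.c2.m₁ fe.c2.m₂ ce.2.1 ce.2.2.1 &&
    (bif tag then classRelQ fe.base.a fe.base.b fe.base.c fe.c2.m₁ fe.base.q₁ fe.base.q₂ C ce.2.1 ce.2.2.2
      else classRelQ fe.a' fe.b' fe.c' fe.c2.m₂ fe.base.q₁ fe.base.q₂ C ce.2.2.1 ce.2.2.2)

/-- **Two-view two-prime sweep**: the Minkowski inequality against `gcd(Δ(g), Δ(h))`, coverage of every prime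
`p < bM` by `q₁`, `q₂`, an `α`-row or an `η`-row, and a class certificate (relative to `q₁, q₂`) of every code of
every row in range, each in its own view — a one-view certificate in the view's order (`classCheck₂`) or a two-view
one (`classCheck2`). Computable. [cite: Marcus2018, Ch. 5, Cor. 2 to Thm. 35] -/
def checkSweepE : Bool :=
  decide (64 * (Int.gcd (MonicCubic.disc fe.base.a fe.base.b fe.base.c) (MonicCubic.disc fe.a' fe.b' fe.c') : ℤ) <
      799 * (fe.base.bM : ℤ) ^ 2) &&
    ((List.range fe.base.bM).all fun n =>
      decide (n < 2) || ClFieldCert.smallFactor n || n == fe.base.q₁ || n == fe.base.q₂ ||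
        (fe.base.primes.any fun e => e.p == n) || fe.primesE.any fun e => e.p == n) &&
    (fe.base.primes.all fun e => decide (fe.base.bM ≤ e.p) ||
      e.codes.all fun C => (e.cls.any fun dd =>
        classCheck₂ fe.base.a fe.base.b fe.base.c fe.base.q₁ fe.base.q₂ fe.base.bM C dd) ||
        fe.c2.certs.any fun ce => fe.classCheck2 true C ce) &&
    fe.primesE.all fun e => decide (fe.base.bM ≤ e.p) ||
      e.codes.all fun C => (e.cls.any fun dd => classCheck₂ fe.a' fe.b' fe.c' fe.base.q₁ fe.base.q₂ fe.base.bM C dd) ||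
        fe.c2.certs.any fun ce => fe.classCheck2 false C ce

/-- **The signature-free two-view two-prime core**: registry core of `base`, the `η` certificate, irreducibility
of `h`, the `η`-registry, the two-view sweep. Computable. -/
def checkCoreE : Bool :=
  fe.base.checkReg && etaCheck fe.base.a fe.base.b fe.base.c fe.u fe.d fe.a' fe.b' fe.c' &&
    noRootMod fe.pIrrE fe.a' fe.b' fe.c' && fe.checkRegistryE && fe.checkSweepE

/-- **The complex two-view two-prime per-field checker**: the complex field clause of `base` (irreducibility,
`Δ < 0`, the isolating interval) and the signature-free core. Computable; `decide +kernel` once per field. -/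
def checkE : Bool := fe.base.checkField && fe.checkCoreE

/-! ## Soundness -/

/-- The field clause of a checked record. -/
theorem checkField_of_checkE (hE : fe.checkE = true) : fe.base.checkField = true := by
  simp only [checkE, Bool.and_eq_true] at hE; exact hE.1

/-- The core clause of a checked record. -/
theorem checkCoreE_of_checkE (hE : fe.checkE = true) : fe.checkCoreE = true := by
  simp only [checkE, Bool.and_eq_true] at hE; exact hE.2

/-- The registry core of `base` holds. -/
theorem checkReg_of_coreE (fe : ClFieldCertEQ) (hE : fe.checkCoreE = true) : fe.base.checkReg = true := by
  simp only [checkCoreE, Bool.and_eq_true] at hE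
  exact hE.1.1.1.1

/-- The `η` certificate holds. -/
theorem etaCheck_of_coreE (fe : ClFieldCertEQ) (hE : fe.checkCoreE = true) :
    etaCheck fe.base.a fe.base.b fe.base.c fe.u fe.d fe.a' fe.b' fe.c' = true := by
  simp only [checkCoreE, Bool.and_eq_true] at hE
  exact hE.1.1.1.2

/-- `0 < d`. -/
theorem d_pos (fe : ClFieldCertEQ) (hE : fe.checkCoreE = true) : 0 < fe.d := pos_of_etaCheck (fe.etaCheck_of_coreE hE)

/-- **`h(η) = 0`.** [folklore] -/
theorem aeval_eta (fe : ClFieldCertEQ) (hθ : aeval θ (MonicCubic.poly fe.base.a fe.base.b fe.base.c) = 0)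
    (hE : fe.checkCoreE = true) : aeval (eta θ fe.u fe.d) (MonicCubic.poly fe.a' fe.b' fe.c') = 0 :=
  aeval_eta_eq_zero hθ (fe.etaCheck_of_coreE hE)

/-- `h` is irreducible. [folklore] -/
theorem irreducibleE (fe : ClFieldCertEQ) (hE : fe.checkCoreE = true) : Irreducible (MonicCubic.polyQ fe.a' fe.b' fe.c') := by
  simp only [checkCoreE, Bool.and_eq_true] at hE
  exact irreducible_of_noRootMod hE.1.1.2

/-- `base` primes are prime (from the primality list). -/
theorem base_primeList (fe : ClFieldCertEQ) (hpr : fe.primeListE.Forall Nat.Prime) : fe.base.primeList.Forall Nat.Prime := by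
  rw [List.forall_iff_forall_mem] at hpr ⊢
  exact fun p hp => hpr p (by simp only [primeListE, List.mem_append]; exact Or.inl hp)

/-- `η`-row primes are prime. -/
theorem prime_of_memE (fe : ClFieldCertEQ) (hpr : fe.primeListE.Forall Nat.Prime) {e : PrimeEntry} (he : e ∈ fe.primesE) :
    e.p.Prime := by
  rw [List.forall_iff_forall_mem] at hpr
  refine hpr _ ?_
  simp only [primeListE, List.mem_append, List.mem_map]
  exact Or.inr ⟨e, he, rfl⟩

/-- Every `η`-row is checked over `(a′, b′, c′)`, and its prime is neither `q₁` nor `q₂`. -/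
theorem rowE_check_of_mem (hE : fe.checkCoreE = true) {e : PrimeEntry} (he : e ∈ fe.primesE) :
    e.check fe.a' fe.b' fe.c' = true ∧ e.p ≠ fe.base.q₁ ∧ e.p ≠ fe.base.q₂ := by
  simp only [checkCoreE, checkRegistryE, Bool.and_eq_true, List.all_eq_true] at hE
  have h := hE.1.2 e he
  exact ⟨h.1.1, by simpa using h.1.2, by simpa using h.2⟩

/-- Soundness of a two-view class certificate in the `α`-view. [cite: Cohen1993, §6.5 (relations)] -/
theorem classIn_of_classCheck2_alpha (hθ : aeval θ (MonicCubic.poly fe.base.a fe.base.b fe.base.c) = 0)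
    (h3 : finrank ℚ K = 3) (hE : fe.checkCoreE = true) {e : PrimeEntry} (hp : e.p.Prime)
    (hrow : e.check fe.base.a fe.base.b fe.base.c = true) {C : PCode} (hC : C ∈ e.codes)
    (hq₁ : fe.base.q₁.Prime) (hq₂ : fe.base.q₂.Prime)
    {ce : (Bool × PCode) × (ℤ × ℤ × ℤ) × (ℤ × ℤ × ℤ) × ℕ} (h : fe.classCheck2 true C ce = true) :
    ClassIn (tsuppClosure (((fe.base.q₁ * fe.base.q₂ : ℕ) : ℕ) : 𝓞 K)) (idealOf hθ C) := by
  simp only [classCheck2, classRelQ, cond_true, Bool.and_eq_true, beq_iff_eq, decide_eq_true_eq] at h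
  obtain ⟨⟨⟨⟨-, rfl⟩, hb⟩, htv⟩, ⟨hcop, hmem⟩, hN⟩ := h
  have hirr := fe.base.irreducible_of_reg (fe.checkReg_of_coreE hE)
  have hη := fe.aeval_eta hθ hE
  have hβ := natCast_mul_twoViewElt_alpha hθ (fe.d_pos hE) hη hb htv
  exact classIn_of_rel2Q hirr hθ h3 hp hrow hC hq₁ hq₂ hcop hmem hβ hN

/-- Soundness of a two-view class certificate in the `η`-view. [cite: Cohen1993, §6.5 (relations)] -/
theorem classIn_of_classCheck2_eta (hθ : aeval θ (MonicCubic.poly fe.base.a fe.base.b fe.base.c) = 0)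
    (h3 : finrank ℚ K = 3) (hE : fe.checkCoreE = true) {e : PrimeEntry} (hp : e.p.Prime)
    (hrow : e.check fe.a' fe.b' fe.c' = true) {C : PCode} (hC : C ∈ e.codes)
    (hq₁ : fe.base.q₁.Prime) (hq₂ : fe.base.q₂.Prime)
    {ce : (Bool × PCode) × (ℤ × ℤ × ℤ) × (ℤ × ℤ × ℤ) × ℕ} (h : fe.classCheck2 false C ce = true) :
    ClassIn (tsuppClosure (((fe.base.q₁ * fe.base.q₂ : ℕ) : ℕ) : 𝓞 K)) (idealOf (fe.aeval_eta hθ hE) C) := by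
  simp only [classCheck2, classRelQ, cond_false, Bool.and_eq_true, beq_iff_eq, decide_eq_true_eq] at h
  obtain ⟨⟨⟨⟨-, rfl⟩, hb⟩, htv⟩, ⟨hcop, hmem⟩, hN⟩ := h
  have hirr' := fe.irreducibleE hE
  have hη := fe.aeval_eta hθ hE
  have hβ := natCast_mul_twoViewElt_eta hθ (fe.d_pos hE) hη hb htv
  exact classIn_of_rel2Q hirr' hη h3 hp hrow hC hq₁ hq₂ hcop hmem hβ hN

/-- **The classes of the ideals containing `q₁·q₂` generate the class group** (two-view two-prime sweep).
[cite: Marcus2018, Ch. 5, Cor. 2 to Thm. 35] [cite: Cohen1993, §6.5] -/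
theorem closure_q2_eq_top_of_coreE (hθ : aeval θ (MonicCubic.poly fe.base.a fe.base.b fe.base.c) = 0)
    (h3 : finrank ℚ K = 3) (hE : fe.checkCoreE = true) (hpr : fe.primeListE.Forall Nat.Prime) :
    Subgroup.closure {cc : ClassGroup (𝓞 K) | ∃ (J : Ideal (𝓞 K)) (hJ : J ∈ (Ideal (𝓞 K))⁰),
      (((fe.base.q₁ * fe.base.q₂ : ℕ) : ℕ) : 𝓞 K) ∈ J ∧ ClassGroup.mk0 ⟨J, hJ⟩ = cc} = ⊤ := by
  have hR := fe.checkReg_of_coreE hE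
  have hprb := fe.base_primeList hpr
  have hirr := fe.base.irreducible_of_reg hR
  have hirr' := fe.irreducibleE hE
  have hη := fe.aeval_eta hθ hE
  have hq₁ := fe.base.q₁_prime hprb
  have hq₂ := fe.base.q₂_prime hprb
  have hE' := hE
  simp only [checkCoreE, checkSweepE, Bool.and_eq_true, decide_eq_true_eq, List.all_eq_true, List.mem_range,
    Bool.or_eq_true, beq_iff_eq, List.any_eq_true] at hE'
  obtain ⟨-, ⟨⟨hd, hcov⟩, hcls⟩, hclsE⟩ := hE'
  change tsuppClosure (((fe.base.q₁ * fe.base.q₂ : ℕ) : ℕ) : 𝓞 K) = ⊤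
  refine eq_top_of_classIn_lt_gcd hirr hθ hirr' hη h3 (b := fe.base.bM) hd fun p hpb hp P hP hlt => ?_
  have hpP : (p : 𝓞 K) ∈ P := sweep_natCast_mem p hP
  have hPr : P.IsPrime := hP.1
  rcases hcov p hpb with ((((hlt2 | hsf) | rfl) | rfl) | ⟨e, he, hep⟩) | ⟨e, he, hep⟩
  · exact absurd hp.two_le (by omega)
  · rw [ClFieldCert.smallFactor_eq_false hp] at hsf; exact absurd hsf Bool.false_ne_true
  · refine ClassIn.of_le (tsuppClosure_le_mul_left fe.base.q₁ fe.base.q₂) ?_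
    rcases fe.base.qcover₁_of_reg hθ h3 hR hprb P hPr hpP with h | h <;> rw [h]
    · exact classIn_tsupp_span_pair_self _ _
    · exact classIn_tsupp_span_pair_self _ _
  · refine ClassIn.of_le (tsuppClosure_le_mul_right fe.base.q₁ fe.base.q₂) ?_
    rcases fe.base.qcover₂_of_reg hθ h3 hR hprb P hPr hpP with h | h <;> rw [h]
    · exact classIn_tsupp_span_pair_self _ _
    · exact classIn_tsupp_span_pair_self _ _
  · subst hep
    have hrow := (fe.base.row_check_of_mem_reg hR he).1
    have hp' := fe.base.prime_of_mem hprb he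
    obtain ⟨C, hC, rfl⟩ := cover_of_check hirr hθ h3 hp' hrow P hPr hpP
    rcases hcls e he with hb | hall
    · exfalso
      refine not_pow_inertiaDeg_lt (mem_primesOver_of_check hirr hθ h3 hp' hrow hC)
        (absNorm_of_check hirr hθ h3 hp' hrow hC) ?_ hlt
      exact hb.trans (Nat.le_self_pow (ClFieldCert.codeDeg_pos C).ne' _)
    · rcases hall C hC with ⟨dd, -, hcc⟩ | ⟨ce, -, hce⟩
      · exact classIn_of_classCheck₂ hirr hθ h3 hp' hrow hC hq₁ hq₂ hcc hlt
      · exact fe.classIn_of_classCheck2_alpha hθ h3 hE hp' hrow hC hq₁ hq₂ hce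
  · -- an `η`-row: the same argument in the `η`-view
    subst hep
    have hrow := (fe.rowE_check_of_mem hE he).1
    have hp' := fe.prime_of_memE hpr he
    obtain ⟨C, hC, rfl⟩ := cover_of_check hirr' hη h3 hp' hrow P hPr hpP
    rcases hclsE e he with hb | hall
    · exfalso
      refine not_pow_inertiaDeg_lt (mem_primesOver_of_check hirr' hη h3 hp' hrow hC)
        (absNorm_of_check hirr' hη h3 hp' hrow hC) ?_ hlt
      exact hb.trans (Nat.le_self_pow (ClFieldCert.codeDeg_pos C).ne' _)
    · rcases hall C hC with ⟨dd, -, hcc⟩ | ⟨ce, -, hce⟩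
      · exact classIn_of_classCheck₂ hirr' hη h3 hp' hrow hC hq₁ hq₂ hcc hlt
      · exact fe.classIn_of_classCheck2_eta hθ h3 hE hp' hrow hC hq₁ hq₂ hce

/-! ## The `η`-registry row and its code primes -/

/-- The `η`-row of the prime `p` (junk if absent). -/
def rowE (p : ℕ) : PrimeEntry := (fe.primesE.find? fun e => e.p == p).getD ⟨p, 2, (0, 0, 0), (0, 0, 0), [], []⟩

/-- A present `η`-row lies in the `η`-registry and has the right prime. -/
theorem rowE_mem (fe : ClFieldCertEQ) {p : ℕ} (h : (fe.primesE.any fun e => e.p == p) = true) :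
    fe.rowE p ∈ fe.primesE ∧ (fe.rowE p).p = p := by
  unfold rowE
  cases hfind : fe.primesE.find? (fun e => e.p == p) with
  | none =>
    exfalso
    rw [List.find?_eq_none] at hfind
    obtain ⟨e, he, hep⟩ := List.any_eq_true.mp h
    exact absurd hep (by simpa using hfind e he)
  | some e =>
    simp only [Option.getD_some]
    exact ⟨List.mem_of_find?_eq_some hfind, by simpa using List.find?_some hfind⟩

variable {fe}

/-- The height-one prime of a code certified present in the `η`-registry (junk `W₁₁r` otherwise). -/
def codePrimeEta (hθ : aeval θ (MonicCubic.poly fe.base.a fe.base.b fe.base.c) = 0) (h3 : finrank ℚ K = 3)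
    (hE : fe.checkCoreE = true) (hpr : fe.primeListE.Forall Nat.Prime) (C : PCode) : HeightOneSpectrum (𝓞 K) :=
  if h : (fe.primesE.any fun e => e.p == C.1) = true ∧ C ∈ (fe.rowE C.1).codes then
    primeOfCode (fe.irreducibleE hE) (fe.aeval_eta hθ hE) h3 (e := fe.rowE C.1)
      (fe.prime_of_memE hpr (fe.rowE_mem h.1).1) (fe.rowE_check_of_mem hE (fe.rowE_mem h.1).1).1 h.2
  else fe.base.W₁₁r hθ h3 (fe.checkReg_of_coreE hE) (fe.base_primeList hpr)

/-- A certified `η`-code prime is presented by its code (in the `η`-view). [folklore] -/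
theorem codePrimeEta_asIdeal {fe : ClFieldCertEQ} (hθ : aeval θ (MonicCubic.poly fe.base.a fe.base.b fe.base.c) = 0)
    (h3 : finrank ℚ K = 3) (hE : fe.checkCoreE = true) (hpr : fe.primeListE.Forall Nat.Prime) {C : PCode}
    (h₁ : (fe.primesE.any fun e => e.p == C.1) = true) (h₂ : C ∈ (fe.rowE C.1).codes) :
    (codePrimeEta hθ h3 hE hpr C).asIdeal = idealOf (fe.aeval_eta hθ hE) C := by
  rw [codePrimeEta, dif_pos ⟨h₁, h₂⟩]
  rfl

end ClFieldCertEQ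

end Summit.BirchSwinnertonDyer.BirchSwinnertonDyer.Rank2Observatory.TwoDescCl
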